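import Summits.ABC.ABC.Theses.IsogenyGlueCongruence

/-!
# Stub `stub_polyDegree_of_depth_of_count` (GLUE) of the line `Sketch` of crux stmt-ABC-2046

What is proved. The bookkeeping composition `A → DEPTH → COUNT → P` of the skeleton of crux B
(`PolyDegreeOfBoundedPrimes`, route IsogenyGlueCongruence). Here A = `DegreePrimesPolyBounded`
(used ONLY as the existence of a modular parametrisation datum at level `N = W.conductorNorm ℤ`),
DEPTH = "below every datum `D₀` there is a datum `D`, `deg D ∣ deg D₀`, all of whose prime powers
satisfy `ℓ^{v_ℓ(deg D)} ≤ C₁ N^{κ₁}`", COUNT = "below every `D₀` there is a `D`, `deg D ∣ deg D₀`,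
with `Σ_{ℓ ∣ deg D} min(v_ℓ(deg D) log ℓ, log N) ≤ κ₂ log N + C₂`", and P = the polynomial
modular-degree statement `∃ κ C, ∀ W …, ∃ D, deg D ≤ C N^κ` (the consequent of the crux).

Proof. Normalise `K₁ = max κ₁ 0`, `B₁ = max C₁ 2`, `M = 1 + K₁ + log B₁ / log 2`. For a curve `W`
chain the data: `D_A` (from A), `D₁` below `D_A` (DEPTH), `D` below `D₁` (COUNT). As
`deg D ∣ deg D₁`, every prime power of `d = deg D` is `≤ B₁ N^{K₁}`, i.e.
`t_ℓ := v_ℓ(d) log ℓ ≤ log B₁ + K₁ log N`, whence `t_ℓ ≤ log B₁ + (1 + K₁) min(t_ℓ, log N)`.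
The number `ω` of prime factors of `d` is `≤ B₁ + 1 + S / log 2`, `S` the truncated sum (each of
its terms is `≥ log 2` when `N ≥ 2`; when `N = 1` every prime factor of `d` is `≤ B₁`). Summing,
`log d = Σ t_ℓ ≤ ω log B₁ + (1 + K₁) S ≤ (B₁ + 1) log B₁ + M S`, which is at most
`(B₁ + 1) log B₁ + M (κ₂ log N + C₂)`; exponentiating, `d ≤ exp((B₁ + 1) log B₁ + M C₂) · N^{M κ₂}`.

Sources: folklore bookkeeping (elementary real analysis and `Nat.factorization`, Mathlib only); no
literature fact is used. This file supports `stmt-ABC-2046`: its main theorem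
`stub_polyDegree_of_depth_of_count` is, verbatim, the registered GLUE stub of the skeleton of the
line `Sketch`; the helper lemmas are prefixed `PolyDegreeOfDepthOfCount.`.
-/

-- single-conjunct summit ABC: the duplicate ABC.ABC is mandated (CONVENTIONS §2)
set_option linter.dupNamespace false

namespace Summit.ABC.ABC.Theorems

open scoped BigOperators

/-! ## Arithmetic of one positive integer through its prime factorisation over `ℝ` -/

/-- `log d = Σ_{ℓ ∣ d} v_ℓ(d) · log ℓ` (sum over the prime factors of `d`). [folklore] -/
theorem PolyDegreeOfDepthOfCount.log_eq_sum_factorization (d : ℕ) :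
    Real.log d = ∑ ℓ ∈ d.primeFactors, (d.factorization ℓ : ℝ) * Real.log ℓ := by
  rw [Real.log_nat_eq_sum_factorization, Finsupp.sum, Nat.support_factorization]

/-- A prime factor of `d` occurs in `d` with multiplicity at least `1`. [folklore] -/
theorem PolyDegreeOfDepthOfCount.one_le_factorization {d ℓ : ℕ} (h : ℓ ∈ d.primeFactors) :
    1 ≤ d.factorization ℓ := by
  rw [← Nat.support_factorization, Finsupp.mem_support_iff] at h
  exact Nat.one_le_iff_ne_zero.mpr h

/-- Logarithmic form of a prime-power bound: `ℓ^v ≤ B · N^K` (with `B, N, ℓ > 0`) gives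
`v · log ℓ ≤ log B + K · log N`. [folklore] -/
theorem PolyDegreeOfDepthOfCount.mul_log_le_of_pow_le {B K : ℝ} {N ℓ v : ℕ} (hB : 0 < B)
    (hN : (0 : ℝ) < N) (hℓ : 0 < ℓ) (h : ((ℓ ^ v : ℕ) : ℝ) ≤ B * (N : ℝ) ^ K) :
    (v : ℝ) * Real.log ℓ ≤ Real.log B + K * Real.log N := by
  have hpos : (0 : ℝ) < ((ℓ ^ v : ℕ) : ℝ) := by exact_mod_cast pow_pos hℓ v
  have h1 : Real.log ((ℓ ^ v : ℕ) : ℝ) ≤ Real.log (B * (N : ℝ) ^ K) := Real.log_le_log hpos h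
  rwa [Nat.cast_pow, Real.log_pow, Real.log_mul hB.ne' (Real.rpow_pos_of_pos hN K).ne',
    Real.log_rpow hN] at h1

/-- The termwise inequality behind the glue: if `0 ≤ t ≤ c + K · L` with `c, K, L ≥ 0`, then
`t ≤ c + (1 + K) · min(t, L)` (case `t ≤ L`: trivial; case `L ≤ t`: the hypothesis). [folklore] -/
theorem PolyDegreeOfDepthOfCount.le_add_mul_min {K c L t : ℝ} (hK : 0 ≤ K) (hc : 0 ≤ c)
    (hL : 0 ≤ L) (ht : 0 ≤ t) (h : t ≤ c + K * L) :
    t ≤ c + (1 + K) * min t L := by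
  rcases le_total t L with htL | hLt
  · rw [min_eq_left htL]
    nlinarith [mul_nonneg hK ht]
  · rw [min_eq_right hLt]
    nlinarith

/-- Summed termwise inequality: if every prime power of `d` is `≤ B₁ · N^{K₁}` (`B₁ ≥ 2`,
`K₁ ≥ 0`, `N ≥ 1`), then
`Σ_{ℓ ∣ d} v_ℓ log ℓ ≤ ω(d) · log B₁ + (1 + K₁) · Σ_{ℓ ∣ d} min(v_ℓ log ℓ, log N)`. [folklore] -/
theorem PolyDegreeOfDepthOfCount.sum_mul_log_le {K₁ B₁ : ℝ} (hK₁ : 0 ≤ K₁) (hB₁ : 2 ≤ B₁)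
    {N d : ℕ} (hN : N ≠ 0)
    (hdepth : ∀ ℓ ∈ d.primeFactors, ((ℓ ^ d.factorization ℓ : ℕ) : ℝ) ≤ B₁ * (N : ℝ) ^ K₁) :
    (∑ ℓ ∈ d.primeFactors, (d.factorization ℓ : ℝ) * Real.log ℓ) ≤
      (d.primeFactors.card : ℝ) * Real.log B₁ +
        (1 + K₁) * ∑ ℓ ∈ d.primeFactors,
          min ((d.factorization ℓ : ℝ) * Real.log ℓ) (Real.log (N : ℝ)) := by
  have hB₁0 : 0 < B₁ := by linarith
  have hlogB₁ : 0 ≤ Real.log B₁ := Real.log_nonneg (by linarith)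
  have hN0 : (0 : ℝ) < N := by exact_mod_cast Nat.pos_of_ne_zero hN
  have hLN0 : 0 ≤ Real.log (N : ℝ) :=
    Real.log_nonneg (by exact_mod_cast Nat.one_le_iff_ne_zero.mpr hN)
  have hterm : ∀ ℓ ∈ d.primeFactors, (d.factorization ℓ : ℝ) * Real.log ℓ ≤
      Real.log B₁ + (1 + K₁) * min ((d.factorization ℓ : ℝ) * Real.log ℓ) (Real.log (N : ℝ)) :=
    fun ℓ hℓ => PolyDegreeOfDepthOfCount.le_add_mul_min hK₁ hlogB₁ hLN0
      (mul_nonneg (Nat.cast_nonneg _) (Real.log_natCast_nonneg ℓ))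
      (PolyDegreeOfDepthOfCount.mul_log_le_of_pow_le hB₁0 hN0 (Nat.pos_of_mem_primeFactors hℓ)
        (hdepth ℓ hℓ))
  calc (∑ ℓ ∈ d.primeFactors, (d.factorization ℓ : ℝ) * Real.log ℓ)
        ≤ ∑ ℓ ∈ d.primeFactors, (Real.log B₁ +
            (1 + K₁) * min ((d.factorization ℓ : ℝ) * Real.log ℓ) (Real.log (N : ℝ))) :=
          Finset.sum_le_sum hterm
    _ = (d.primeFactors.card : ℝ) * Real.log B₁ +
          (1 + K₁) * ∑ ℓ ∈ d.primeFactors,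
            min ((d.factorization ℓ : ℝ) * Real.log ℓ) (Real.log (N : ℝ)) := by
          rw [Finset.sum_add_distrib, Finset.sum_const, nsmul_eq_mul, Finset.mul_sum]

/-- The number of prime factors: if every prime power of `d` is `≤ B₁ · N^{K₁}` (`B₁ ≥ 2`, `N ≥ 1`),
then `ω(d) ≤ B₁ + 1 + (Σ_{ℓ ∣ d} min(v_ℓ log ℓ, log N)) / log 2` — for `N ≥ 2` each term of the sum
is `≥ log 2`; for `N = 1` every prime factor of `d` is `≤ B₁`. [folklore] -/
theorem PolyDegreeOfDepthOfCount.card_primeFactors_le {K₁ B₁ : ℝ} (hB₁ : 2 ≤ B₁) {N d : ℕ}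
    (hN : N ≠ 0)
    (hdepth : ∀ ℓ ∈ d.primeFactors, ((ℓ ^ d.factorization ℓ : ℕ) : ℝ) ≤ B₁ * (N : ℝ) ^ K₁) :
    (d.primeFactors.card : ℝ) ≤ B₁ + 1 +
      (∑ ℓ ∈ d.primeFactors, min ((d.factorization ℓ : ℝ) * Real.log ℓ) (Real.log (N : ℝ))) /
        Real.log 2 := by
  have hlog2 : 0 < Real.log 2 := Real.log_pos one_lt_two
  have hLN0 : 0 ≤ Real.log (N : ℝ) :=
    Real.log_nonneg (by exact_mod_cast Nat.one_le_iff_ne_zero.mpr hN)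
  have hS0 : 0 ≤ ∑ ℓ ∈ d.primeFactors,
      min ((d.factorization ℓ : ℝ) * Real.log ℓ) (Real.log (N : ℝ)) :=
    Finset.sum_nonneg fun ℓ _ =>
      le_min (mul_nonneg (Nat.cast_nonneg _) (Real.log_natCast_nonneg ℓ)) hLN0
  rcases lt_or_ge N 2 with hN2 | hN2
  · -- `N = 1`: every prime factor `ℓ = ℓ¹ ≤ ℓ^{v_ℓ} ≤ B₁`, so `primeFactors d ⊆ range (⌊B₁⌋₊ + 1)`
    obtain rfl : N = 1 := by omega
    have hsub : d.primeFactors ⊆ Finset.range (⌊B₁⌋₊ + 1) := by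
      intro ℓ hℓ
      have hℓp : ℓ.Prime := Nat.prime_of_mem_primeFactors hℓ
      have hle : (ℓ : ℝ) ≤ B₁ := by
        have h := hdepth ℓ hℓ
        rw [Nat.cast_one, Real.one_rpow, mul_one] at h
        calc (ℓ : ℝ) = ((ℓ ^ 1 : ℕ) : ℝ) := by rw [pow_one]
          _ ≤ ((ℓ ^ d.factorization ℓ : ℕ) : ℝ) := by
              exact_mod_cast Nat.pow_le_pow_right hℓp.pos
                (PolyDegreeOfDepthOfCount.one_le_factorization hℓ)
          _ ≤ B₁ := h
      exact Finset.mem_range.mpr (Nat.lt_succ_of_le (Nat.le_floor hle))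
    have hcard : d.primeFactors.card ≤ ⌊B₁⌋₊ + 1 :=
      (Finset.card_le_card hsub).trans_eq (Finset.card_range _)
    have hcard' : (d.primeFactors.card : ℝ) ≤ (⌊B₁⌋₊ : ℝ) + 1 := by exact_mod_cast hcard
    have hfloor : (⌊B₁⌋₊ : ℝ) ≤ B₁ := Nat.floor_le (by linarith)
    have hdiv := div_nonneg hS0 hlog2.le
    linarith
  · -- `N ≥ 2`: each term of the truncated sum is `≥ log 2`
    have hLN2 : Real.log 2 ≤ Real.log (N : ℝ) :=
      Real.log_le_log two_pos (by exact_mod_cast hN2)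
    have hmin : ∀ ℓ ∈ d.primeFactors,
        Real.log 2 ≤ min ((d.factorization ℓ : ℝ) * Real.log ℓ) (Real.log (N : ℝ)) := by
      intro ℓ hℓ
      have hℓp : ℓ.Prime := Nat.prime_of_mem_primeFactors hℓ
      refine le_min ?_ hLN2
      have hlogℓ : Real.log 2 ≤ Real.log ℓ :=
        Real.log_le_log two_pos (by exact_mod_cast hℓp.two_le)
      have h1 : (1 : ℝ) ≤ (d.factorization ℓ : ℝ) := by
        exact_mod_cast PolyDegreeOfDepthOfCount.one_le_factorization hℓ
      calc Real.log 2 = 1 * Real.log 2 := (one_mul _).symm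
        _ ≤ (d.factorization ℓ : ℝ) * Real.log ℓ :=
            mul_le_mul h1 hlogℓ hlog2.le (zero_le_one.trans h1)
    have hsum := Finset.card_nsmul_le_sum _ _ _ hmin
    rw [nsmul_eq_mul] at hsum
    have hcard : (d.primeFactors.card : ℝ) ≤
        (∑ ℓ ∈ d.primeFactors, min ((d.factorization ℓ : ℝ) * Real.log ℓ) (Real.log (N : ℝ))) /
          Real.log 2 := by
      rw [le_div_iff₀ hlog2]
      exact hsum
    linarith

/-- **Core estimate.** Let `d, N ≥ 1`, `K₁ ≥ 0`, `B₁ ≥ 2`, `1 + K₁ + log B₁ / log 2 ≤ M`. If every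
prime power of `d` is `≤ B₁ · N^{K₁}` (DEPTH) and
`Σ_{ℓ ∣ d} min(v_ℓ log ℓ, log N) ≤ K₂ log N + B₂` (COUNT), then
`d ≤ exp((B₁ + 1) log B₁ + M B₂) · N^{M K₂}`. [folklore] -/
theorem PolyDegreeOfDepthOfCount.le_exp_mul_rpow {K₁ B₁ K₂ B₂ M : ℝ} (hK₁ : 0 ≤ K₁) (hB₁ : 2 ≤ B₁)
    (hM : 1 + K₁ + Real.log B₁ / Real.log 2 ≤ M) {N d : ℕ} (hN : N ≠ 0) (hd : d ≠ 0)
    (hdepth : ∀ ℓ ∈ d.primeFactors, ((ℓ ^ d.factorization ℓ : ℕ) : ℝ) ≤ B₁ * (N : ℝ) ^ K₁)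
    (hcount : (∑ ℓ ∈ d.primeFactors,
        min ((d.factorization ℓ : ℝ) * Real.log ℓ) (Real.log (N : ℝ))) ≤
      K₂ * Real.log (N : ℝ) + B₂) :
    (d : ℝ) ≤ Real.exp ((B₁ + 1) * Real.log B₁ + M * B₂) * (N : ℝ) ^ (M * K₂) := by
  have hlog2 : 0 < Real.log 2 := Real.log_pos one_lt_two
  have hlogB₁ : 0 ≤ Real.log B₁ := Real.log_nonneg (by linarith)
  have hN0 : (0 : ℝ) < N := by exact_mod_cast Nat.pos_of_ne_zero hN
  have hLN0 : 0 ≤ Real.log (N : ℝ) :=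
    Real.log_nonneg (by exact_mod_cast Nat.one_le_iff_ne_zero.mpr hN)
  have hd0 : (0 : ℝ) < d := by exact_mod_cast Nat.pos_of_ne_zero hd
  have hquot : 0 ≤ Real.log B₁ / Real.log 2 := div_nonneg hlogB₁ hlog2.le
  have hM0 : 0 ≤ M := by linarith
  -- name the three real quantities
  obtain ⟨S, hS⟩ : ∃ S : ℝ, S = ∑ ℓ ∈ d.primeFactors,
      min ((d.factorization ℓ : ℝ) * Real.log ℓ) (Real.log (N : ℝ)) := ⟨_, rfl⟩
  obtain ⟨T, hT⟩ : ∃ T : ℝ, T = ∑ ℓ ∈ d.primeFactors, (d.factorization ℓ : ℝ) * Real.log ℓ :=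
    ⟨_, rfl⟩
  obtain ⟨ω, hω⟩ : ∃ ω : ℝ, ω = (d.primeFactors.card : ℝ) := ⟨_, rfl⟩
  have hS0 : 0 ≤ S := hS ▸ Finset.sum_nonneg fun ℓ _ =>
    le_min (mul_nonneg (Nat.cast_nonneg _) (Real.log_natCast_nonneg ℓ)) hLN0
  have h1 : Real.log d = T := hT ▸ PolyDegreeOfDepthOfCount.log_eq_sum_factorization d
  have h2 : T ≤ ω * Real.log B₁ + (1 + K₁) * S := by
    rw [hT, hω, hS]; exact PolyDegreeOfDepthOfCount.sum_mul_log_le hK₁ hB₁ hN hdepth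
  have h3 : ω ≤ B₁ + 1 + S / Real.log 2 := by
    rw [hω, hS]; exact PolyDegreeOfDepthOfCount.card_primeFactors_le hB₁ hN hdepth
  have h4 : S ≤ K₂ * Real.log (N : ℝ) + B₂ := hS ▸ hcount
  have h5 : ω * Real.log B₁ ≤ (B₁ + 1 + S / Real.log 2) * Real.log B₁ :=
    mul_le_mul_of_nonneg_right h3 hlogB₁
  have h6 : (B₁ + 1 + S / Real.log 2) * Real.log B₁ + (1 + K₁) * S =
      (B₁ + 1) * Real.log B₁ + (1 + K₁ + Real.log B₁ / Real.log 2) * S := by ring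
  have h7 : (1 + K₁ + Real.log B₁ / Real.log 2) * S ≤ M * S :=
    mul_le_mul_of_nonneg_right hM hS0
  have h8 : M * S ≤ M * (K₂ * Real.log (N : ℝ) + B₂) := mul_le_mul_of_nonneg_left h4 hM0
  have hlogd : Real.log d ≤ (B₁ + 1) * Real.log B₁ + M * B₂ + Real.log (N : ℝ) * (M * K₂) := by
    rw [h1]
    have h9 : M * (K₂ * Real.log (N : ℝ) + B₂) = M * B₂ + Real.log (N : ℝ) * (M * K₂) := by ring
    linarith
  calc (d : ℝ) = Real.exp (Real.log d) := (Real.exp_log hd0).symm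
    _ ≤ Real.exp ((B₁ + 1) * Real.log B₁ + M * B₂ + Real.log (N : ℝ) * (M * K₂)) :=
        Real.exp_le_exp.mpr hlogd
    _ = Real.exp ((B₁ + 1) * Real.log B₁ + M * B₂) * Real.exp (Real.log (N : ℝ) * (M * K₂)) :=
        Real.exp_add _ _
    _ = Real.exp ((B₁ + 1) * Real.log B₁ + M * B₂) * (N : ℝ) ^ (M * K₂) := by
        rw [Real.rpow_def_of_pos hN0]

/-! ## Normalisation of the constants and transfer along divisibility -/

/-- Monotonicity of `C · N^κ` in `(C, κ)` for `N ≥ 1` and `0 ≤ B`: `C ≤ B`, `κ ≤ K` give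
`C · N^κ ≤ B · N^K`. [folklore] -/
theorem PolyDegreeOfDepthOfCount.mul_rpow_mono {N C B κ K : ℝ} (hN : 1 ≤ N) (hCB : C ≤ B)
    (hκK : κ ≤ K) (hB : 0 ≤ B) : C * N ^ κ ≤ B * N ^ K :=
  (mul_le_mul_of_nonneg_right hCB (Real.rpow_nonneg (zero_le_one.trans hN) κ)).trans
    (mul_le_mul_of_nonneg_left (Real.rpow_le_rpow_of_exponent_le hN hκK) hB)

/-- Prime powers are monotone along divisibility: `d ∣ d₁` (both `≠ 0`) and `ℓ > 0` give
`ℓ^{v_ℓ(d)} ≤ ℓ^{v_ℓ(d₁)}`. [folklore] -/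
theorem PolyDegreeOfDepthOfCount.pow_factorization_le_of_dvd {d d₁ ℓ : ℕ} (hd : d ≠ 0)
    (hd₁ : d₁ ≠ 0) (h : d ∣ d₁) (hℓ : 0 < ℓ) :
    ℓ ^ d.factorization ℓ ≤ ℓ ^ d₁.factorization ℓ :=
  Nat.pow_le_pow_right hℓ ((Nat.factorization_le_iff_dvd hd hd₁).mpr h ℓ)

/-! ## The registered stub -/

/-- **GLUE stub of the line `Sketch` (crux stmt-ABC-2046), registered form:**
`A → DEPTH → COUNT → P`. Hypothesis A supplies a datum `D_A` at level `N`; DEPTH below `D_A` gives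
`D₁` with all prime powers of `deg D₁` at most `C₁ N^{κ₁}`; COUNT below `D₁` gives `D` with
`deg D ∣ deg D₁` (so the same prime-power bound) and truncated log-mass `≤ κ₂ log N + C₂`; the core
estimate `PolyDegreeOfDepthOfCount.le_exp_mul_rpow` then bounds `deg D ≤ C · N^κ` with
`κ = M κ₂`, `C = exp((B₁ + 1) log B₁ + M C₂)`, `B₁ = max C₁ 2`, `M = 1 + max κ₁ 0 + log B₁ / log 2`.
[folklore] -/
theorem stub_polyDegree_of_depth_of_count : Summit.ABC.ABC.Theses.IsogenyGlueCongruence.DegreePrimesPolyBounded → (∃ κ C : ℝ, ∀ (W : WeierstrassCurve ℚ) [W.IsElliptic] [W.IsGloballyMinimal] [NeZero (W.conductorNorm ℤ)], W.IsSemistable ℤ → ∀ D₀ : Literature.NumberTheory.EllipticCurves.ModularForms.ModularParametrizationData W (W.conductorNorm ℤ), ∃ D : Literature.NumberTheory.EllipticCurves.ModularForms.ModularParametrizationData W (W.conductorNorm ℤ), D.modularDegree ∣ D₀.modularDegree ∧ ∀ ℓ : ℕ, ℓ.Prime → ((ℓ ^ (D.modularDegree).factorization ℓ : ℕ) : ℝ)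 ≤ C * (W.conductorNorm ℤ : ℝ) ^ κ) → (∃ κ C : ℝ, ∀ (W : WeierstrassCurve ℚ) [W.IsElliptic] [W.IsGloballyMinimal] [NeZero (W.conductorNorm ℤ)], W.IsSemistable ℤ → ∀ D₀ : Literature.NumberTheory.EllipticCurves.ModularForms.ModularParametrizationData W (W.conductorNorm ℤ), ∃ D : Literature.NumberTheory.EllipticCurves.ModularForms.ModularParametrizationData W (W.conductorNorm ℤ), D.modularDegree ∣ D₀.modularDegree ∧ (∑ ℓ ∈ (D.modularDegree).primeFactors, min (((D.modularDegree).factorization ℓ : ℝ) * Real.log ℓ) (Real.log (W.conductorNorm ℤ : ℝ))) ≤ κ * Real.log (W.conductorNorm ℤ : ℝ) + C) → ∃ κ C : ℝ, ∀ (W : WeierstrassCurve ℚ) [W.IsElliptic] [W.IsGloballyMinimal] [NeZero (W.conductorNorm ℤ)], W.IsSemistable ℤ → ∃ D : Literature.NumberTheory.EllipticCurves.ModularForms.ModularParametrizationData W (W.conductorNorm ℤ), (D.modularDegree : ℝ) ≤ C * (W.conductorNorm ℤ : ℝ) ^ κ := by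
  intro hA hD hC
  obtain ⟨κA, CA, hA⟩ := hA
  obtain ⟨κ₁, C₁, hD⟩ := hD
  obtain ⟨κ₂, C₂, hC⟩ := hC
  -- normalised constants `K₁ ≥ max κ₁ 0`, `B₁ ≥ max C₁ 2`, `M = 1 + K₁ + log B₁ / log 2`
  obtain ⟨K₁, hK₁, hκK₁⟩ : ∃ K : ℝ, 0 ≤ K ∧ κ₁ ≤ K := ⟨max κ₁ 0, le_max_right _ _, le_max_left _ _⟩
  obtain ⟨B₁, hB₁, hCB₁⟩ : ∃ B : ℝ, 2 ≤ B ∧ C₁ ≤ B := ⟨max C₁ 2, le_max_right _ _, le_max_left _ _⟩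
  obtain ⟨M, hM⟩ : ∃ M : ℝ, 1 + K₁ + Real.log B₁ / Real.log 2 ≤ M := ⟨_, le_rfl⟩
  refine ⟨M * κ₂, Real.exp ((B₁ + 1) * Real.log B₁ + M * C₂), ?_⟩
  intro W _ _ _ hW
  -- the chain of data: A, then DEPTH below it, then COUNT below that
  obtain ⟨DA, -⟩ := hA W hW
  obtain ⟨D₁, -, hD₁⟩ := hD W hW DA
  obtain ⟨D, hdvd, hD₂⟩ := hC W hW D₁
  have hN0 : W.conductorNorm ℤ ≠ 0 := NeZero.ne _
  have hN1 : (1 : ℝ) ≤ (W.conductorNorm ℤ : ℝ) := by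
    exact_mod_cast Nat.one_le_iff_ne_zero.mpr hN0
  refine ⟨D, PolyDegreeOfDepthOfCount.le_exp_mul_rpow hK₁ hB₁ hM hN0 D.deg_pos.ne' ?_ hD₂⟩
  -- DEPTH for `deg D` from DEPTH for `deg D₁` along `deg D ∣ deg D₁`, constants normalised
  intro ℓ hℓ
  have hℓp : ℓ.Prime := Nat.prime_of_mem_primeFactors hℓ
  calc ((ℓ ^ (D.modularDegree).factorization ℓ : ℕ) : ℝ)
      ≤ ((ℓ ^ (D₁.modularDegree).factorization ℓ : ℕ) : ℝ) := by
        exact_mod_cast PolyDegreeOfDepthOfCount.pow_factorization_le_of_dvd D.deg_pos.ne'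
          D₁.deg_pos.ne' hdvd hℓp.pos
    _ ≤ C₁ * (W.conductorNorm ℤ : ℝ) ^ κ₁ := hD₁ ℓ hℓp
    _ ≤ B₁ * (W.conductorNorm ℤ : ℝ) ^ K₁ :=
        PolyDegreeOfDepthOfCount.mul_rpow_mono hN1 hCB₁ hκK₁ (by linarith)

end Summit.ABC.ABC.Theorems
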